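import Summits.KontsevichZagierPeriods.KontsevichZagierPeriods.Theses.TorsionLogs

/-!
# Route KontsevichZagierPeriods/TorsionLogs — `Assembly`: the route's cruxes imply the summit

Problem `KontsevichZagierPeriods`, route `TorsionLogs`, item stmt-KontsevichZagierPeriods-13813
(`Assembly`, assembly, rank 1). The route declaration `Assembly` is the curried implication
`NeronTorsionSector → TorsionSectorComplete → KontsevichZagierPeriods`.

The proof is pure bookkeeping over the Kontsevich–Zagier calculus of moves
(`Literature.NumberTheory.Transcendental.KZCalculus`):
* the summit `KontsevichZagierPeriods` asks, for two rational-shape representations `r, r'` with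
  `r.value = r'.value`, that `KZ.Equivalent r r'`, i.e. `[r] - [r'] ∈ KZ.relations`;
* the relative-completeness crux `TorsionSectorComplete` puts `[r] - [r']` in
  `KZ.relations ⊔ AddSubgroup.closure S`, where `S` is the set of tied Néron–torsion elements
  `M • [rI] + k • [rP] - m • [rL]` (hypotheses of `NeronTorsionSector` repeated verbatim, tie
  `4N²k = M(N−2a)²` included);
* the sector crux `NeronTorsionSector` says precisely `S ⊆ KZ.relations`, hence
  `AddSubgroup.closure S ≤ KZ.relations` (`AddSubgroup.closure_le`) and the sup collapses to
  `KZ.relations` (`sup_le le_rfl _`).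

The term is the same as the route's deciding theorem `TorsionLogs.closes`, re-proved here
self-containedly so that the item is closed by a `Theorems` declaration whose type is literally
the route declaration.

Sources: M. Kontsevich, D. Zagier, *Periods* (2001), §1.2 (Conjecture 1, rules 1–3, and the
kernel reformulation); A. Huber, S. Müller-Stach, *Periods and Nori Motives* (2017), §13.1.
Deliberately NOT here: any claim about the two hypotheses themselves — the result is the
implication only (unconditional as an implication; `TorsionSectorComplete` is period-conjecture
strength and open, `NeronTorsionSector` is the route's rank-2 crux).
-/

namespace Summit.KontsevichZagierPeriods.TorsionLogs

open Summit.KontsevichZagierPeriods.KontsevichZagierPeriods.Theses.TorsionLogs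

/-- Settles stmt-KontsevichZagierPeriods-13813: the route declaration `TorsionLogs.Assembly`
(`NeronTorsionSector → TorsionSectorComplete → KontsevichZagierPeriods`) holds. For rational
representations `r, r'` with equal values, `TorsionSectorComplete` puts `[r] - [r']` in
`KZ.relations ⊔ AddSubgroup.closure S` with `S` the set of tied Néron–torsion elements
`M • [rI] + k • [rP] - m • [rL]`, and `NeronTorsionSector` gives `S ⊆ KZ.relations` element by
element (its hypotheses are repeated verbatim in the definition of `S`), so
`AddSubgroup.closure S ≤ KZ.relations` and `[r] - [r'] ∈ KZ.relations`, i.e. `KZ.Equivalent r r'`.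
[Kontsevich–Zagier 2001, §1.2] [folklore] -/
theorem Assembly_proof :
    Summit.KontsevichZagierPeriods.KontsevichZagierPeriods.Theses.TorsionLogs.Assembly := by
  unfold Summit.KontsevichZagierPeriods.KontsevichZagierPeriods.Theses.TorsionLogs.Assembly
  intro h₁ h₂ n m r r' hr hr' hv
  -- it suffices that `closure S ≤ relations`, i.e. `S ⊆ relations`
  refine (sup_le le_rfl ((AddSubgroup.closure_le _).mpr ?_)) (h₂ r r' hr hr' hv)
  -- which is exactly the crux `NeronTorsionSector`, element by element
  rintro d ⟨g₂, g₃, e₁, xP, yP, α, N, a, M, k, m', f, rI, rP, rL, hf, hdisc, he, he0, hpos, hx, hy,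
    hN, ha, ha', htie, htor, hρ, hα, hdI, hiI, hdP, hiP, hdL, hiL, hval, rfl⟩
  exact h₁ g₂ g₃ e₁ xP yP α N a M k m' f hf hdisc he he0 hpos hx hy hN ha ha' htie htor hρ hα rI rP
    rL hdI hiI hdP hiP hdL hiL hval

end Summit.KontsevichZagierPeriods.TorsionLogs
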